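import Literature.NumberTheory.LFunctions.FeketePolyaKernelCertificatesWeighted
import Literature.NumberTheory.LFunctions.FeketePolyaReweighted
import HarnessLib

/-!
# Reweighted Fekete–Pólya certificates: factor lists, their expansion, and the bounds the engine needs

Topic `Literature/NumberTheory/LFunctions`; namespace `Literature.NumberTheory.LFunctions.FeketePolyaKernel`
(sequel of `FeketePolyaKernelCertificatesWeighted.lean`, `FeketePolyaReweighted.lean`). Small computable
definitions (`twOf`) and THEOREMS (no named fact, no `sorry`): a FACTOR LIST `fs = [(p₁, ε₁), …]` (`p_i ≥ 2`,
`ε_i = ±1`) stands for the positive Euler-type factor `G(s) = ∏ (1 + ε_i p_i^{−s})`; `twOf fs` is its expansion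
`[(d, c_d)]`; here: `G(σ) = ∏(1 + ε p^{−σ}) > 0` (`rwG_twOf`, `rwG_twOf_pos`), `a(1) = ℜχ(1)` (`rwSeq_twOf_one`),
`|a| ≤ |twOf fs|`, `|S(a, N)| ≤ |twOf fs|·q` (`abs_rwSeq_le`, `abs_summatory_rwSeq_le`), periodicity of the integer
stream (`rwValZ_add_period`) and its identification with `rwSeq` (`cast_rwValZ`) — the hypotheses of
`FeketePolyaReweighted.lfunction_ne_zero_of_reweighted` for the streams the kernel certifies.

## References

* H. L. Montgomery, R. C. Vaughan, *Multiplicative Number Theory I*, CUP 2007, §4.3 (4.23), §11.2.1 Exercises 7–8.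
  [MontgomeryVaughan2007]
-/

namespace Literature.NumberTheory.LFunctions

namespace FeketePolyaKernel

open Finset Literature.Analysis.Convolution FeketePolyaTable FeketePolyaReweighted
  Literature.Barriers.RiemannHypothesis

/-! ### Factor lists and their expansion -/

/-- **Expansion of a factor list**: `twOf [] = [(1, 1)]`, `twOf ((p, ε) :: rest) = twOf rest ++ [(p·d, ε·c)]_{(d,c) ∈ twOf rest}`
— the pairs `(d, c_d)` of `∏ (1 + ε p^{−s}) = Σ c_d d^{−s}`. [cite: MontgomeryVaughan2007, §11.2.1 Exercise 8] -/
def twOf : List (ℕ × ℤ) → List (ℕ × ℤ)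
  | [] => [(1, 1)]
  | (p, ε) :: rest => twOf rest ++ (twOf rest).map fun dc => (p * dc.1, ε * dc.2)

/-- Entries of the expansion: `d ≥ 1` and `c = ±1` (factors with `p ≥ 2`, `ε = ±1`). [cite: MontgomeryVaughan2007, §11.2.1 Exercise 8] -/
theorem twOf_props : ∀ fs : List (ℕ × ℤ), (∀ pe ∈ fs, 2 ≤ pe.1 ∧ (pe.2 = 1 ∨ pe.2 = -1)) →
    ∀ dc ∈ twOf fs, 1 ≤ dc.1 ∧ (dc.2 = 1 ∨ dc.2 = -1)
  | [], _, dc, hdc => by simp [twOf] at hdc; subst hdc; simp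
  | (p, ε) :: rest, h, dc, hdc => by
    have hp : 2 ≤ p ∧ (ε = 1 ∨ ε = -1) := h (p, ε) (by simp)
    have ih := twOf_props rest fun pe hpe => h pe (by simp [hpe])
    simp only [twOf, List.mem_append, List.mem_map] at hdc
    rcases hdc with hdc | ⟨dc', hdc', rfl⟩
    · exact ih dc hdc
    · obtain ⟨h1, h2⟩ := ih dc' hdc'
      refine ⟨le_trans h1 (Nat.le_mul_of_pos_left _ (by omega)), ?_⟩
      rcases hp.2 with hε | hε <;> rcases h2 with hc | hc <;> simp [hε, hc]

/-- `G(σ)` of the expansion is the product `∏ (1 + ε p^{−σ})`. [cite: MontgomeryVaughan2007, §11.2.1 Exercise 8] -/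
theorem rwG_twOf (σ : ℝ) : ∀ fs : List (ℕ × ℤ),
    rwG (twOf fs) σ = (fs.map fun pe => 1 + (pe.2 : ℝ) * (pe.1 : ℝ) ^ (-σ)).prod
  | [] => by simp [twOf, rwG]
  | (p, ε) :: rest => by
    have ih := rwG_twOf σ rest
    simp only [rwG, twOf, List.map_append, List.map_map, List.sum_append, List.map_cons, List.prod_cons] at ih ⊢
    have hmap : ((twOf rest).map ((fun dc : ℕ × ℤ => (dc.2 : ℝ) * (dc.1 : ℝ) ^ (-σ)) ∘ fun dc => (p * dc.1, ε * dc.2))).sum =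
        (ε : ℝ) * (p : ℝ) ^ (-σ) * ((twOf rest).map fun dc : ℕ × ℤ => (dc.2 : ℝ) * (dc.1 : ℝ) ^ (-σ)).sum := by
      rw [← List.sum_map_mul_left]
      congr 1
      refine List.map_congr_left fun dc _ => ?_
      simp only [Function.comp]
      push_cast
      rw [Real.mul_rpow (by positivity) (by positivity)]
      ring
    rw [hmap, ih]
    ring

/-- `G(σ) > 0` for `σ ≥ 0`... for `σ > 0`: each factor `1 + ε p^{−σ}` is positive (`p ≥ 2`, `|ε| = 1`).
[cite: MontgomeryVaughan2007, §11.2.1 Exercise 8] -/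
theorem rwG_twOf_pos {σ : ℝ} (hσ : 0 < σ) : ∀ fs : List (ℕ × ℤ), (∀ pe ∈ fs, 2 ≤ pe.1 ∧ (pe.2 = 1 ∨ pe.2 = -1)) →
    0 < rwG (twOf fs) σ := by
  intro fs hfs
  rw [rwG_twOf]
  refine List.prod_pos fun x hx => ?_
  rw [List.mem_map] at hx
  obtain ⟨pe, hpe, rfl⟩ := hx
  obtain ⟨hp, hε⟩ := hfs pe hpe
  have hp1 : (1 : ℝ) < pe.1 := by exact_mod_cast (show 1 < pe.1 by omega)
  have hlt : (pe.1 : ℝ) ^ (-σ) < 1 := Real.rpow_lt_one_of_one_lt_of_neg hp1 (by linarith)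
  have h0 : 0 ≤ (pe.1 : ℝ) ^ (-σ) := by positivity
  rcases hε with h | h <;> rw [h] <;> push_cast <;> linarith

/-- `rwSeq` is additive in the list. [cite: MontgomeryVaughan2007, §11.2.1 Exercise 8] -/
private theorem rwSeq_append {q : ℕ} (χ : DirichletCharacter ℂ q) (l₁ l₂ : List (ℕ × ℤ)) (n : ℕ) :
    rwSeq χ (l₁ ++ l₂) n = rwSeq χ l₁ n + rwSeq χ l₂ n := by
  simp [rwSeq, List.map_append, List.sum_append]

/-- `a(1) = ℜχ(1)` for the expansion of a factor list (the dilated terms vanish at `n = 1`).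
[cite: MontgomeryVaughan2007, §11.2.1 Exercise 8] -/
theorem rwSeq_twOf_one {q : ℕ} (χ : DirichletCharacter ℂ q) : ∀ fs : List (ℕ × ℤ),
    (∀ pe ∈ fs, 2 ≤ pe.1 ∧ (pe.2 = 1 ∨ pe.2 = -1)) → rwSeq χ (twOf fs) 1 = (χ ((1 : ℕ) : ZMod q)).re
  | [], _ => by simp [twOf, rwSeq]
  | (p, ε) :: rest, h => by
    have hp : 2 ≤ p := (h (p, ε) (by simp)).1
    have hrest : ∀ pe ∈ rest, 2 ≤ pe.1 ∧ (pe.2 = 1 ∨ pe.2 = -1) := fun pe hpe => h pe (by simp [hpe])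
    rw [twOf, rwSeq_append, rwSeq_twOf_one χ rest hrest]
    suffices hz : rwSeq χ ((twOf rest).map fun dc => (p * dc.1, ε * dc.2)) 1 = 0 by rw [hz, add_zero]
    unfold rwSeq
    rw [List.map_map, List.sum_eq_zero]
    intro x hx
    rw [List.mem_map] at hx
    obtain ⟨dc, hdc, rfl⟩ := hx
    have hd := (twOf_props rest hrest dc hdc).1
    simp only [Function.comp]
    rw [if_neg]
    intro hdiv
    have := Nat.le_of_dvd one_pos hdiv
    nlinarith

/-- `|a(n)| ≤ |tw|` when every `c = ±1`. [cite: MontgomeryVaughan2007, §11.2.1 Exercise 8] -/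
theorem abs_rwSeq_le {q : ℕ} (χ : DirichletCharacter ℂ q) : ∀ (tw : List (ℕ × ℤ)),
    (∀ dc ∈ tw, dc.2 = 1 ∨ dc.2 = -1) → ∀ n, |rwSeq χ tw n| ≤ tw.length
  | [], _, n => by simp [rwSeq]
  | dc :: rest, h, n => by
    have ih := abs_rwSeq_le χ rest (fun dc' h' => h dc' (by simp [h'])) n
    have hc := h dc (by simp)
    have hterm : |(if dc.1 ∣ n then (dc.2 : ℝ) * (χ ((n / dc.1 : ℕ) : ZMod q)).re else 0)| ≤ 1 := by
      split_ifs
      · rw [abs_mul]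
        have h1 : |(dc.2 : ℝ)| = 1 := by rcases hc with h | h <;> simp [h]
        rw [h1, one_mul]
        exact abs_re_apply_natCast_le χ _
      · simp
    have hsplit : rwSeq χ (dc :: rest) n =
        (if dc.1 ∣ n then (dc.2 : ℝ) * (χ ((n / dc.1 : ℕ) : ZMod q)).re else 0) + rwSeq χ rest n := by
      simp [rwSeq]
    rw [hsplit, List.length_cons]
    push_cast
    exact (abs_add_le _ _).trans (by linarith)

/-- Summatory function of a dilated sequence: `Σ_{n ≤ N} [d ∣ n] g(n/d) = Σ_{m ≤ N/d} g(m)` (`d ≥ 1`). [folklore] -/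
private theorem summatory_dilate (g : ℕ → ℝ) {d : ℕ} (hd : 1 ≤ d) :
    ∀ N : ℕ, summatory (fun n ↦ if d ∣ n then g (n / d) else 0) N = summatory g (N / d)
  | 0 => by simp [summatory]
  | N + 1 => by
    rw [summatory_succ, summatory_dilate g hd N, Nat.succ_div]
    by_cases h : d ∣ N + 1
    · rw [if_pos h, if_pos h, summatory_succ]
    · rw [if_neg h, if_neg h, add_zero, add_zero]

/-- `|S(a, N)| ≤ |tw|·q`: each dilated summatory function of `ℜχ` is bounded by `q` (MV (4.23)).
[cite: MontgomeryVaughan2007, §4.3 eq. (4.23)] -/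
theorem abs_summatory_rwSeq_le {q : ℕ} [NeZero q] (χ : DirichletCharacter ℂ q) (hχ : χ ≠ 1) :
    ∀ (tw : List (ℕ × ℤ)), (∀ dc ∈ tw, 1 ≤ dc.1 ∧ (dc.2 = 1 ∨ dc.2 = -1)) →
    ∀ N, |summatory (rwSeq χ tw) N| ≤ tw.length * q
  | [], _, N => by simp [rwSeq, summatory]
  | dc :: rest, h, N => by
    obtain ⟨hd, hc⟩ := h dc (by simp)
    have ih := abs_summatory_rwSeq_le χ hχ rest (fun dc' h' => h dc' (by simp [h'])) N
    have hsplit : summatory (rwSeq χ (dc :: rest)) N =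
        (dc.2 : ℝ) * summatory (fun n ↦ if dc.1 ∣ n then (χ ((n / dc.1 : ℕ) : ZMod q)).re else 0) N +
          summatory (rwSeq χ rest) N := by
      simp only [summatory, rwSeq, List.map_cons, List.sum_cons, Finset.sum_add_distrib, Finset.mul_sum]
      congr 1
      refine Finset.sum_congr rfl fun n _ => ?_
      split_ifs <;> simp
    rw [hsplit, summatory_dilate (fun m ↦ (χ (m : ZMod q)).re) hd, List.length_cons]
    have h1 : |(dc.2 : ℝ)| = 1 := by rcases hc with h | h <;> simp [h]
    have hS := abs_summatory_re_le χ hχ (N / dc.1)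
    calc |(dc.2 : ℝ) * summatory (fun n ↦ (χ (n : ZMod q)).re) (N / dc.1) + summatory (rwSeq χ rest) N|
        ≤ |(dc.2 : ℝ) * summatory (fun n ↦ (χ (n : ZMod q)).re) (N / dc.1)| + |summatory (rwSeq χ rest) N| :=
          abs_add_le _ _
      _ ≤ q + rest.length * q := by rw [abs_mul, h1, one_mul]; exact add_le_add hS ih
      _ = ((rest.length + 1 : ℕ) : ℝ) * q := by push_cast; ring

/-! ### The integer stream: periodicity and identification -/

/-- A `Q`-periodic function is determined by its values on `n mod Q`. [cite: MontgomeryVaughan2007, §11.2.1 Exercise 7 (f)] -/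
theorem periodic_mod' {f : ℕ → ℤ} {Q : ℕ} (hf : ∀ n, f (n + Q) = f n) (n : ℕ) : f (n % Q) = f n := by
  have key : ∀ k r, f (r + Q * k) = f r := fun k => by
    induction k with
    | zero => intro r; simp
    | succ k ih => intro r; rw [Nat.mul_succ, ← add_assoc, hf, ih]
  conv_rhs => rw [← Nat.mod_add_div n Q]
  exact (key _ _).symm

/-- Periodicity of the reweighted integer stream: period `N` when `d·q ∣ N` for every term and `v` is `q`-periodic.
[cite: MontgomeryVaughan2007, §11.2.1 Exercise 8] -/
theorem rwValZ_add_period {v : ℕ → ℤ} {q N : ℕ} (hper : ∀ n, v (n + q) = v n) :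
    ∀ tw : List (ℕ × ℤ), (∀ dc ∈ tw, 1 ≤ dc.1 ∧ dc.1 * q ∣ N) → ∀ n, rwValZ v tw (n + N) = rwValZ v tw n
  | [], _, n => by simp [rwValZ]
  | dc :: rest, h, n => by
    obtain ⟨hd, hdq⟩ := h dc (by simp)
    have ih := rwValZ_add_period hper rest (fun dc' h' => h dc' (by simp [h'])) n
    simp only [rwValZ, List.map_cons, List.sum_cons] at ih ⊢
    rw [ih]
    congr 1
    have hdN : dc.1 ∣ N := dvd_trans (dvd_mul_right _ _) hdq
    have hiff : dc.1 ∣ n + N ↔ dc.1 ∣ n := (Nat.dvd_add_left hdN)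
    obtain ⟨k, hk⟩ := hdq
    have hperk : ∀ m j : ℕ, v (m + q * j) = v m := fun m j => by
      induction j with
      | zero => simp
      | succ j ihj => rw [Nat.mul_succ, ← add_assoc, hper, ihj]
    by_cases hdn : dc.1 ∣ n
    · rw [if_pos (hiff.mpr hdn), if_pos hdn, Nat.add_div_of_dvd_left hdN, hk,
        show dc.1 * q * k / dc.1 = q * k by rw [mul_assoc, Nat.mul_div_cancel_left _ (by omega)], hperk]
    · rw [if_neg (fun h' => hdn (hiff.mp h')), if_neg hdn]

/-- The integer stream cast to `ℝ` is `rwSeq`. [cite: MontgomeryVaughan2007, §11.2.1 Exercise 8] -/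
theorem cast_rwValZ {q : ℕ} (χ : DirichletCharacter ℂ q) {v : ℕ → ℤ} (hv : ∀ n : ℕ, (χ (n : ZMod q)).re = v n) :
    ∀ (tw : List (ℕ × ℤ)) (n : ℕ), (rwValZ v tw n : ℝ) = rwSeq χ tw n
  | [], n => by simp [rwValZ, rwSeq]
  | dc :: rest, n => by
    have ih := cast_rwValZ χ hv rest n
    have hL : rwValZ v (dc :: rest) n = (if dc.1 ∣ n then dc.2 * v (n / dc.1) else 0) + rwValZ v rest n := by
      simp [rwValZ]
    have hR : rwSeq χ (dc :: rest) n =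
        (if dc.1 ∣ n then (dc.2 : ℝ) * (χ ((n / dc.1 : ℕ) : ZMod q)).re else 0) + rwSeq χ rest n := by
      simp [rwSeq]
    rw [hL, hR, Int.cast_add, ih, hv]
    split_ifs <;> simp

end FeketePolyaKernel

end Literature.NumberTheory.LFunctions
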